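import Literature.AnabelianGeometry.AbsoluteAnabelian.AbsTopII.InertiaGroups
import Literature.AnabelianGeometry.AbsoluteAnabelian.FreeProlCyclicEncoding
import Literature.AnabelianGeometry.AbsoluteAnabelian.FreeProcyclicModel
import Literature.AnabelianGeometry.SemiGraphs.PSCRamification

/-!
# [AbsTopII] Prop 1.3 (i) "`I_e ≅ Ẑ^Σ`" (cusp) from layer L3's PSC vocabulary, `Σ = {l}`

S. Mochizuki, *Topics in Absolute Anabelian Geometry II* [AbsTopII] (bib `MochizukiAbsTopII2013`;
locators = PDF pages of the kurims manuscript `paper:url-585b8d0ad0d9`), §1, Proposition 1.3 (i)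
p. 11: "If `e` is a cusp of `𝔾`, then as abstract profinite groups, `I_e ≅ Ẑ^Σ`", with `I_e := Π_e`
(Def 1.2 (ii) p. 10); proof p. 12: "Assertion (i) follows immediately from the definitions" — i.e.
from the structure of the edge-like subgroups of the PSC-fundamental group `Π_𝔾` of the semi-graph
of anabelioids of pro-`Σ` PSC-type `𝔾` ([CombGC] Rmk 1.1.3 "`Π_e ≅ Ẑ^Σ`").

abc-iut-L4-t6 typed (i) as the predicate `DPSCIndexData.Prop_1_3_i` (FACT-LIST F-0297) on abstract
DPSC data, whose `Π_𝔾`-part is NOT YET derived from layer L3's PSC interface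
(`SemiGraphs.PSCDatum`, abc-iut-L3-t4; "TODO-merge" in `AbsTopII/DecompositionGroups.lean`).  Layer
L3 does not record [CombGC] Rmk 1.1.3 as a field, but it carries the NAMED characterisation
`SemiGraphs.PSCDatum.CuspidalEdgeLikeCharacterization` ([IUTchI] Rmk 1.2.3 (iv), FACT-LIST F-1930 /
F-1931) which, for `Σ = {l}`, says in particular that every cuspidal edge-like subgroup of `Π_𝔾` is
closed, topologically monogenic and infinite; by the cell's encoding lemma
(`AbsTopII.isFreeProSigmaCyclic_singleton_iff_of_isProSigma`, abc-iut-w5-d062 lineage) this is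
exactly `IsFreeProSigmaCyclic {l}`.

This proof-only file (no definitions) records the resulting BRIDGE — the DAG edge
"F-0297 ⇐ F-1930 at `Σ = {l}`" of `plan/L4/SUBDAG-AbsTopII-Prop13.md` (input row P13/I-i,
"dischargeable BY NAME from L3 via the bridge"):

* `AbsTopII.DPSCIndexData.prop_1_3_i_of_cuspidalEdgeLikeCharacterization` — if `Π_𝔾 ⊆ Π_H` carries
  a PSC datum `G` with `Σ_G = Σ = {l}` whose cuspidal subgroups include the chosen `Π_e` of every
  cusp `e` of the DPSC data, then `G.CuspidalEdgeLikeCharacterization → X.Prop_1_3_i`.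

-- TODO(general form): print has an arbitrary nonempty set of primes `Σ`; the L3 characterisation
-- (and [IUTchI] Rmk 1.2.3 (iv) itself) is stated for `Σ = {l}` only, and [CombGC] Rmk 1.1.3
-- "`Π_e ≅ Ẑ^Σ`" is not a typed row, so the general-`Σ` bridge has no L3 source today.
HONEST FRAMING: typed ≠ proved; the PSC datum and its characterisation are hypotheses; nothing here
bears on [IUTchIII] Cor 3.12.
-/

namespace Literature.AnabelianGeometry.AbsoluteAnabelian.AbsTopII.DPSCIndexData

open Literature.AnabelianGeometry.SemiGraphs

universe u

variable (X : DPSCIndexData.{u})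

/-- **[AbsTopII] Prop 1.3 (i) as typed (`Prop_1_3_i`, F-0297) from layer L3, `Σ = {l}`.**  Let the
closed normal subgroup `Π_𝔾 ⊆ Π_H` of the DPSC data carry a PSC datum `G` ([CombGC] Def 1.1) with
`Σ_G = Σ = {l}`, such that the chosen cuspidal subgroup `Π_e ⊆ Π_𝔾` of every cusp `e` is a cuspidal
edge-like subgroup of `G`.  If `G` satisfies [IUTchI] Rmk 1.2.3 (iv)
(`CuspidalEdgeLikeCharacterization`: the cuspidal edge-like subgroups are the maximal closed,
topologically monogenic, infinite subgroups with the total-ramification property), then every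
`I_e = Π_e` is free pro-`{l}`-cyclic: "as abstract profinite groups, `I_e ≅ Ẑ^Σ`" ("follows
immediately from the definitions", p. 12), via the encoding lemma
`isFreeProSigmaCyclic_singleton_iff_of_isProSigma` in the pro-`l` group `Π_𝔾`.
[cite: MochizukiAbsTopII2013, Prop 1.3 (i) p.11] [cite: Mochizuki2012, IUTchI Rmk 1.2.3(iv) pp.41-42] -/
theorem prop_1_3_i_of_cuspidalEdgeLikeCharacterization (G : PSCDatum ↥X.PiG) {l : ℕ}
    (hS : G.Sigma = {l}) (hXS : X.Sigma = {l})
    (hcusp : ∀ e : X.Cusp, G.IsCuspidal ((X.cuspSub e).subgroupOf X.PiG))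
    (h : G.CuspidalEdgeLikeCharacterization) :
    Literature.AnabelianGeometry.AbsoluteAnabelian.AbsTopII.DPSCIndexData.Prop_1_3_i X := by
  intro e
  -- `Π_𝔾` is a profinite pro-`l` group
  haveI : CompactSpace ↥X.PiG := isCompact_iff_compactSpace.mp X.isClosed_PiG.isCompact
  haveI : Fact l.Prime := ⟨G.sigma_prime l (by rw [hS]; exact Set.mem_singleton l)⟩
  have hP : IsProSigma {l} ↥X.PiG := hS ▸ G.proSigma
  -- the chosen `Π_e`, viewed inside `Π_𝔾`, is cuspidal, hence closed, monogenic, infinite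
  set A : Subgroup ↥X.PiG := (X.cuspSub e).subgroupOf X.PiG with hA
  obtain ⟨⟨hAc, hgen, hinf, -⟩, -⟩ := (h l hS A).mp (hcusp e)
  have hcyc : IsFreeProSigmaCyclic {l} ↥A :=
    (isFreeProSigmaCyclic_singleton_iff_of_isProSigma hP hAc).mpr ⟨hgen, hinf⟩
  -- transport along `Π_e ∩ Π_𝔾 ≃ₜ* Π_e` (`Π_e ⊆ Π_𝔾`)
  have hle : X.cuspSub e ≤ X.PiG := X.cuspSub_le e
  let f : ↥A ≃ₜ* ↥(X.cuspSub e) :=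
    { Subgroup.subgroupOfEquivOfLe hle with
      continuous_toFun := by
        show Continuous fun g : ↥A => (⟨((g : ↥X.PiG) : X.PiH), g.2⟩ : ↥(X.cuspSub e))
        exact (continuous_subtype_val.comp continuous_subtype_val).subtype_mk _
      continuous_invFun := by
        show Continuous fun g : ↥(X.cuspSub e) => (⟨⟨(g : X.PiH), hle g.2⟩, g.2⟩ : ↥A)
        exact (continuous_subtype_val.subtype_mk _).subtype_mk _ }
  have hcyc' : IsFreeProSigmaCyclic {l} ↥(X.cuspSub e) := hcyc.of_continuousMulEquiv f
  change IsFreeProSigmaCyclic X.Sigma ↥(X.cuspSub e)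
  rw [hXS]
  exact hcyc'

end Literature.AnabelianGeometry.AbsoluteAnabelian.AbsTopII.DPSCIndexData
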